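import Summits.AtomisticToContinuum.FouriersLaw.Theses.BoundaryEscapeDeficit
import Summits.AtomisticToContinuum.FouriersLaw.Theses.JunctionLocality
import Summits.AtomisticToContinuum.FouriersLaw.Theorems.JunctionLocalitySuperadditiveResistanceStubLinearResponsePlain

/-!
# Split glue for `BoundedResponseConverges` (crux stmt-AtomisticToContinuum-9141) — import-cycle-free carrier for ALL four routes

Helper file (`--supports stmt-AtomisticToContinuum-9141`, line `escape-deficit-dichotomy`, lead c20, route affinity
`LocalOhmBV`). REVISION 2 (same seat): the only import beyond the two child route files is now
`Theorems/JunctionLocalitySuperadditiveResistanceStubLinearResponsePlain` (for the landed `responseIdentity_proof`), whose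
closure holds the Theses files BondHeatUncertainty, BoundaryEscapeDeficit, EmbeddedDrudeMourre, JunctionLocality,
PhononMeanFreePath ONLY — so this module can be the `--glue-by` of the split on EVERY route wanting the crux
(OddSectorIrreversibility, TransferKernelPositivity, LocalOhmBV, MatthiessenLadder) without an import cycle; revision 1
(p151459) imported `…EscapeDeficitForm` (closure ∋ `Theses.OddSectorIrreversibility`) and served three of the four. The
identity it needs is re-derived below in the `dite` form the child 12238 literally uses (`responseCoeff_eq_escapeDeficit_dite`,
three lines from `responseIdentity_proof`). The paragraphs below are revision 1's account, kept. The exact two-piece split of the crux,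

  `BoundaryEscapeDeficit.EscapeNonOscillation` (stmt-12238) ∧ `JunctionLocality.ConductanceLowerBound` (stmt-11749)
    ⟹ `BoundedResponseConverges`,

is already proved as `Summit.AtomisticToContinuum.FouriersLaw.Theorems.boundedResponseConverges_of_subs`
(`Theorems/OddSectorIrreversibilityBoundedResponseConvergesSplit.lean`, p137843). That module also carries the CONVERSE
halves and therefore imports `BondHeatUncertaintyPositiveOrInfiniteLimitSlots` / `…Split`, whose import closure contains
`Theses.LocalOhmBV` (410 modules; computed from the `import` headers 2026-08-17). Consequently
`ledger route edit route-AtomisticToContinuum-LocalOhmBV --split BoundedResponseConverges --glue-by <that theorem>` cannot be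
applied: the gate renders `theorem …GlueBy_holds : … := _root_.<glue_by>` INTO `Theses/LocalOhmBV.lean`, which would then
import itself (strategist s2, `Cruxes/BoundedResponseConverges/STRATEGY-CENSUS-s2-LOBV.md` §1, `SPLIT-PROPOSAL-s2.md` item 4).

This file proves the FORWARD glue only (revision 1 over the landed `responseCoeff_eq_escapeDeficit` of module
`…EscapeDeficitForm`, closure 399 modules, Theses files in it: BondHeatUncertainty, BoundaryEscapeDeficit, ContactEchoEpochs,
EmbeddedDrudeMourre, FeketeResistance, FeketeSeriesLaw, FourierGreenKubo, HonestZwanzig, JunctionLocality,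
OddSectorIrreversibility, PhononMeanFreePath, SuperadditiveJunction; revision 2 over `responseIdentity_proof` directly, see the
header). So `splitGlueBy_boundedResponseConverges` below is a valid `--glue-by` argument for the split on every route; the
route twins `⟨Route⟩.BoundedResponseConverges` are syntactically identical `def`s unfolding to the written-out conclusion, so
the rendered glue type-checks by δ-unfolding (certified in `Cruxes/BoundedResponseConverges/SplitCertLocalOhmBV.lean`).

Mathematics (unchanged from p137843, pure real analysis): along any steady family under weak-NESS uniqueness the response
coefficient `D N` IS the escape-deficit term `(N−1)·γ·E_N` for `N ≥ 1`, so the `EReal` limit of 12238 is an `EReal` limit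
of `D`; the crux's own `BddAbove (range |D|)` caps it, the floor of 11749 bounds it below, hence it is a real `k ≥ c > 0`
and `D N → k`. Standard axioms.
-/

noncomputable section

open MeasureTheory Filter Topology Set

namespace Summit.AtomisticToContinuum.FouriersLaw.Theorems.LocalOhmBVSplitGlue

open Literature.MathematicalPhysics.KineticTheory.HeatConduction
open Summit.AtomisticToContinuum.FouriersLaw.Theses

/-- **Squeeze in `EReal`.** A real sequence whose `EReal` image converges, bounded above and eventually above a
positive floor `c`, converges in `ℝ` to some `k > 0`. [folklore] -/
theorem exists_pos_tendsto_of_ereal_tendsto_of_le_of_floor (D : ℕ → ℝ) {ℓ : EReal}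
    (hℓ : Tendsto (fun N : ℕ => ((D N : ℝ) : EReal)) atTop (𝓝 ℓ))
    {B : ℝ} (hB : ∀ N, D N ≤ B) {c : ℝ} (hc : 0 < c) {N₁ : ℕ} (hfloor : ∀ N, N₁ ≤ N → c ≤ D N) :
    ∃ k : ℝ, 0 < k ∧ Tendsto D atTop (𝓝 k) := by
  have hℓ_le : ℓ ≤ ((B : ℝ) : EReal) :=
    le_of_tendsto' hℓ fun N => EReal.coe_le_coe_iff.2 (hB N)
  have hev : ∀ᶠ N : ℕ in atTop, ((c : ℝ) : EReal) ≤ ((D N : ℝ) : EReal) :=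
    (eventually_ge_atTop N₁).mono fun N hN => EReal.coe_le_coe_iff.2 (hfloor N hN)
  have hℓ_ge : ((c : ℝ) : EReal) ≤ ℓ := ge_of_tendsto hℓ hev
  have hℓ_top : ℓ ≠ ⊤ := ne_top_of_le_ne_top (EReal.coe_ne_top _) hℓ_le
  have hℓ_bot : ℓ ≠ ⊥ := ne_bot_of_le_ne_bot (EReal.coe_ne_bot _) hℓ_ge
  refine ⟨ℓ.toReal, ?_, ?_⟩
  · rw [← EReal.coe_toReal hℓ_top hℓ_bot, EReal.coe_le_coe_iff] at hℓ_ge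
    exact lt_of_lt_of_le hc hℓ_ge
  · rw [← EReal.coe_toReal hℓ_top hℓ_bot] at hℓ
    exact EReal.tendsto_coe.1 hℓ

/-- **Response coefficient = escape-deficit term, `dite` form.** Under weak-NESS uniqueness, along any steady family of
`pinnedChain ω₂ lam β γ` (all `> 0`), at `T > 0` and `N ≥ 1`, the clause-(ii) response coefficient `d` equals
`(N−1)·γ·(1 − (γ/T²)∫_{(0,∞)} K_N)` with `K_N` written exactly as the `let K` of route `BoundaryEscapeDeficit` (the
`if h : 0 < N then … else 0` kept), by the landed `responseIdentity_proof` and uniqueness of limits along `𝓝[≠] 0`.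
[cite: KunduDharNarayan2009, arXiv:0809.4543 p. 3] -/
theorem responseCoeff_eq_escapeDeficit_dite {ω₂ lam β γ : ℝ} (hω : 0 < ω₂) (hl : 0 < lam) (hβ : 0 < β) (hγ : 0 < γ)
    (hU : ∀ (N : ℕ) (T_L T_R : ℝ), 0 < T_L → 0 < T_R → ∀ μ ν : Measure (PhaseSpace N),
      (pinnedChain ω₂ lam β γ).IsSteadyState N T_L T_R μ →
        (pinnedChain ω₂ lam β γ).IsSteadyState N T_L T_R ν → μ = ν)
    (μ : (N : ℕ) → ℝ → ℝ → Measure (PhaseSpace N))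
    (hμ : ∀ (N : ℕ) (T_L T_R : ℝ), 0 < T_L → 0 < T_R →
      (pinnedChain ω₂ lam β γ).IsSteadyState N T_L T_R (μ N T_L T_R))
    {T : ℝ} (hT : 0 < T) {N : ℕ} (hN : 0 < N) {d : ℝ}
    (hd : Tendsto (fun δ : ℝ =>
        (pinnedChain ω₂ lam β γ).totalCurrent (μ N (T + δ / 2) (T - δ / 2)) / δ) (𝓝[≠] 0) (𝓝 d)) :
    d = ((N : ℝ) - 1) * γ * (1 - γ / T ^ 2 * ∫ u in Set.Ioi (0 : ℝ),
      (if h : 0 < N then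
          ∫ z, ((z.2 ⟨0, h⟩) ^ 2 - T) * (∫ y, ((y.2 ⟨0, h⟩) ^ 2 - T)
            ∂((pinnedChain ω₂ lam β γ).transitionKernel N T T u.toNNReal z))
            ∂((pinnedChain ω₂ lam β γ).gibbsMeasure N T)
        else 0)) := by
  have h := Summit.AtomisticToContinuum.FouriersLaw.Cruxes.SuperadditiveResistance.ThermaliseThenCutProbeInsertion.responseIdentity_proof
    ω₂ lam β γ hω hl hβ hγ hU μ hμ T hT
  dsimp only at h
  obtain ⟨-, hlim⟩ := h N hN
  exact tendsto_nhds_unique hd hlim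

/-- **Split glue, cycle-free carrier: `EscapeNonOscillation → ConductanceLowerBound → BoundedResponseConverges`.**
Along any steady-state family of `pinnedChain ω₂ lam β γ` (all `> 0`) under weak-NESS uniqueness, at `T > 0`, the response
coefficients are `(N−1)·γ·E_N` for `N ≥ 1` (`responseCoeff_eq_escapeDeficit`), so the `EReal` limit of item 12238 is an
`EReal` limit of `N ↦ D N`; boundedness (the crux's hypothesis) and the floor of item 11749 make it a real limit
`k ≥ c > 0`. The conclusion is the crux statement WRITTEN OUT (the ledger signature of stmt-AtomisticToContinuum-9141
verbatim, which every route twin `⟨Route⟩.BoundedResponseConverges` unfolds to), so the theorem is the rendered glue type of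
any route up to δ-unfolding while its module's import closure avoids `Theses.LocalOhmBV` — the by-name form over the
`OddSectorIrreversibility` twin is the landed `boundedResponseConverges_of_subs` (p137843), whose module cannot be imported
into `Theses/LocalOhmBV.lean`. [folklore] -/
theorem splitGlueBy_boundedResponseConverges : Summit.AtomisticToContinuum.FouriersLaw.Theses.BoundaryEscapeDeficit.EscapeNonOscillation → Summit.AtomisticToContinuum.FouriersLaw.Theses.JunctionLocality.ConductanceLowerBound → ∀ ω₂ lam β γ : ℝ, 0 < ω₂ → 0 < lam → 0 < β → 0 < γ → (∀ (N : ℕ) (T_L T_R : ℝ), 0 < T_L → 0 < T_R → ∀ μ ν : MeasureTheory.Measure (Literature.MathematicalPhysics.KineticTheory.HeatConduction.PhaseSpace N), (Literature.MathematicalPhysics.KineticTheory.HeatConduction.pinnedChain ω₂ lam β γ).IsSteadyState N T_L T_R μ → (Literature.MathematicalPhysics.KineticTheory.HeatConduction.pinnedChain ω₂ lam β γ).IsSteadyState N T_L T_R ν → μ = ν) → ∀ μ : (N : ℕ) → ℝ → ℝ → MeasureTheory.Measure (Literature.MathematicalPhysics.KineticTheory.HeatConduction.PhaseSpace N), (∀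 (N : ℕ) (T_L T_R : ℝ), 0 < T_L → 0 < T_R → (Literature.MathematicalPhysics.KineticTheory.HeatConduction.pinnedChain ω₂ lam β γ).IsSteadyState N T_L T_R (μ N T_L T_R)) → ∀ T : ℝ, 0 < T → ∀ D : ℕ → ℝ, (∀ N : ℕ, Filter.Tendsto (fun δ : ℝ => (Literature.MathematicalPhysics.KineticTheory.HeatConduction.pinnedChain ω₂ lam β γ).totalCurrent (μ N (T + δ / 2) (T - δ / 2)) / δ) (nhdsWithin 0 {(0 : ℝ)}ᶜ) (nhds (D N))) → BddAbove (Set.range fun N => |D N|) → ∃ k : ℝ, 0 < k ∧ Filter.Tendsto D Filter.atTop (nhds k) := by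
  intro hNO hF ω₂ lam β γ hω hl hβ hγ hU μ hμ T hT D hD hbdd
  obtain ⟨c, hc, N₁, hfloor⟩ := hF ω₂ lam β γ hω hl hβ hγ hU μ hμ T hT D hD
  have h := hNO ω₂ lam β γ hω hl hβ hγ T hT
  dsimp only at h
  obtain ⟨ℓ, hℓ⟩ := h
  -- the `EReal` limit of `(N-1)γE_N` is an `EReal` limit of `D` (they agree for `N ≥ 1`)
  have hℓD : Tendsto (fun N : ℕ => ((D N : ℝ) : EReal)) atTop (𝓝 ℓ) := by
    refine hℓ.congr' ?_
    filter_upwards [eventually_gt_atTop 0] with N hN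
    rw [EReal.coe_eq_coe_iff]
    exact (responseCoeff_eq_escapeDeficit_dite hω hl hβ hγ hU μ hμ hT hN (hD N)).symm
  obtain ⟨B, hB⟩ := hbdd
  have hB' : ∀ N, D N ≤ B := fun N => (le_abs_self _).trans (hB ⟨N, rfl⟩)
  exact exists_pos_tendsto_of_ereal_tendsto_of_le_of_floor D hℓD hB' hc hfloor

end Summit.AtomisticToContinuum.FouriersLaw.Theorems.LocalOhmBVSplitGlue
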